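import Summits.CriticalPhenomena.PercolationContinuityZ3.Theorems.Transplant.SkelPhiWinChainS
import Summits.CriticalPhenomena.PercolationContinuityZ3.Theorems.Transplant.SkelPhiKitsStepI
import HarnessLib

/-!
# D″ node, LEVEL 1 (b)+(c) joined at the PLAIN-WINDOW instance: the schedule-generic window chain `SkelPhiWinChainS` at
# `𝒲 = planarWindowWin hlip w₀ R` (`G' = winGraph G w₀ R`) — `rfl` bridges to hp-8's level data (`stepL = winLData`, `stepD = Win (region)`,
# `coreT = Win (next core)`; habitat bridges likewise) and **`KitsAt` of a chain step FROM THE STEP-I′ CERTIFICATE** (`kitsAt_stepA_win` =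
# `WinChainData.kitsAt_stepA` with `hkits` discharged level by level by `Skelφ.kitClause_stepI`, the room read from the schedule by `roomS`)

builds on p205010 (kernel theorem, internal audit signed; external expert review pending) — nothing in this file uses p205010.
Lane `prim-bschramm`, seat `prim-bschramm-p1` (gen 9); helper file (`--supports stmt-CriticalPhenomena-4575 --as helper`).
* §1 `WinChainData.stepL_win/_in`, `PlanarWindow.stepD_win/_in`, `PlanarWindow.coreT_win/_in` (all `rfl`), `winLevel_subset_stepD_win`;
* §2 **`WinChainData.kitsAt_stepA_win`**, **`kitsAt_stepA_win'`** (level-window form: `tanOff ℓs M ≤ j₀` instead of the core width).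
[cite: KozmaNitzan2024, §4 Lemma 10 (pp. 17–22), Lemma 11 (pp. 22–23)]
-/

noncomputable section

open scoped Classical

namespace Summit.CriticalPhenomena.PercolationContinuityZ3.Theorems.Transplant

namespace Skelφ

open MeasureTheory
open Literature.Probability.Percolation Literature.Probability.LatticeModels SimpleGraph KNLevels
open Literature.Barriers.CriticalPhenomena (graphBall graphBall_finite mem_graphBall_self graphBall_mono)
open Skel (winGraph winGraph_adj winGraph_le KitGeom winGraphIn)
open SkelI (tanOff)
open Literature.Probability.Percolation.KozmaNitzan.Cells (oth oth_ne eq_oth_of_ne oth_oth)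
open ChainPlanar

variable {V : Type} [DecidableEq V] {G : SimpleGraph V} [G.LocallyFinite] {φ : V → Site 2} {types : Finset V}

/-! ## §1 Bridges at the instances -/

section Bridges

variable (hlip : Lip G φ) (P : WinChainData V) (S : Schedule)

/-- The levels of a chain step in the plain window are hp-8's `winLData`. [folklore] -/
theorem WinChainData.stepL_win (w₀ : V) (R k : ℕ) :
    P.stepL (planarWindowWin hlip w₀ R) S k = winLData G φ w₀ R (S.lo k) (S.hi k) P.o P.Sfin := rfl

/-- The region of a chain step in the plain window. [folklore] -/
theorem PlanarWindow.stepD_win (w₀ : V) (R k : ℕ) : (planarWindowWin hlip w₀ R).stepD S k = Win G φ w₀ (S.region k) R := rfl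

/-- The true target of a chain step in the plain window. [folklore] -/
theorem PlanarWindow.coreT_win (w₀ : V) (R k : ℕ) : (planarWindowWin hlip w₀ R).coreT S k = Win G φ w₀ (S.core (k + 1)) R := rfl

/-- The levels of a chain step in a habitat window are hp-8's `winLDataIn`. [folklore] -/
theorem WinChainData.stepL_in (Ω : Finset V) (k : ℕ) :
    P.stepL (planarWindowIn hlip Ω) S k = winLDataIn G φ Ω (S.lo k) (S.hi k) P.o P.Sfin := rfl

/-- The region of a chain step in a habitat window. [folklore] -/
theorem PlanarWindow.stepD_in (Ω : Finset V) (k : ℕ) : (planarWindowIn hlip Ω).stepD S k = WinIn φ Ω (S.region k) := rfl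

/-- The true target of a chain step in a habitat window. [folklore] -/
theorem PlanarWindow.coreT_in (Ω : Finset V) (k : ℕ) : (planarWindowIn hlip Ω).coreT S k = WinIn φ Ω (S.core (k + 1)) := rfl

/-- A plain window level `j ≤ R'` of step `k ≤ N` lies in the step's region. [cite: KozmaNitzan2024, §4 Lemma 10 (p. 17: B⟨R+1⟩ ⊆ D)] -/
theorem winLevel_subset_stepD_win (w₀ : V) (R : ℕ) {k : ℕ} (hk : k ≤ S.N) {j : ℕ} (hj : j ≤ S.R') :
    winLevel G φ w₀ R (S.lo k) (S.hi k) j ⊆ (planarWindowWin hlip w₀ R).stepD S k :=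
  (planarWindowWin hlip w₀ R).mono (S.level_subset_region hk hj)

/-- A habitat window level `j ≤ R'` of step `k ≤ N` lies in the step's region. [cite: KozmaNitzan2024, §4 Lemma 10 (p. 17: B⟨R+1⟩ ⊆ D)] -/
theorem winLevelIn_subset_stepD_in (Ω : Finset V) {k : ℕ} (hk : k ≤ S.N) {j : ℕ} (hj : j ≤ S.R') :
    winLevelIn φ Ω (S.lo k) (S.hi k) j ⊆ (planarWindowIn hlip Ω).stepD S k :=
  (planarWindowIn hlip Ω).mono (S.level_subset_region hk hj)

end Bridges

/-! ## §2 `KitsAt` of a chain step from the Step-I′ certificate -/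

/-- **`KitsAt` OF STEP `k` OF A WINDOW CHAIN IN `winGraph G w₀ R` FROM THE STEP-I′ CERTIFICATE**: `WinChainData.kitsAt_stepA` with the per-level
kit clause supplied by `Skelφ.kitClause_stepI` — region `Win w₀ (S.region k) R`, target `Win w₀ (S.core (k+1)) R ∪ Rim k` (far inner neighbours of
every level of the window inside it), the planar room from the schedule (`roomS`). Level-independent data: the kit (`Mz`, `ℓK`, `A`, `Rk`), the
slab/shell rooms with the core box `2·T₀` wide, the route rooms (`S.ℓ₀ > Mz`, certified extents `[S.ℓ₀, S.ℓ₁]` along `S.ax k`, depth, spread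
`S.Wb k ≥` certified), the kit number `kk` and the count `P.N`. [cite: KozmaNitzan2024, §4 Lemma 10 (pp. 17–22), Lemma 11 (pp. 22–23)] -/
theorem WinChainData.kitsAt_stepA_win [Countable V] (hlip : Lip G φ) (hstep : Steps G φ) (hfr : Frames G φ types) (hκ : CylConn G φ types)
    {Δ : ℕ} (hΔ : ∀ v, G.degree v ≤ Δ) {p : unitInterval} (hC : CylSubcritical G φ types p) {D : StepI.Data V} {off : ℕ}
    (hD : D.Λ = fatSeqOff hfr hC off) {Sz Sx Sy : Finset ℕ} {q : unitInterval} {δ : ℝ} (hδ : 0 < δ)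
    (h : ∀ i ∈ StepI.index types Sz Sx Sy, 1 - δ ^ 2 < (bondPercolation G q).real (StepI.event G φ D i))
    (P : WinChainData V) (S : Schedule) {w₀ : V} {R : ℕ}
    -- the chain step
    (hRl : P.Rlev + 1 ≤ S.R') (hRim : ∀ k, P.Rim k ⊆ (planarWindowWin hlip w₀ R).stepD S k) {k : ℕ} (hk : k ≤ S.N)
    (hTne : ((planarWindowWin hlip w₀ R).coreT S k).Nonempty) {Wt : Sym2 V → unitInterval}
    (hsub : IsSubbox (winGraph G w₀ R) Wt q ((planarWindowWin hlip w₀ R).stepD S k)) (hfin : FinSupp Wt P.Sfin)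
    (hDS : (planarWindowWin hlip w₀ R).stepD S k ⊆ P.Sfin) (ho : P.o ∉ (planarWindowWin hlip w₀ R).stepD S k) (hoS : P.o ∈ P.Sfin)
    (hj : P.j₁ ≤ P.Rlev) (hcount : 1 / (1 - (q : ℝ)) ^ (Δ * P.N) ≤ δ * ((Finset.Icc P.j₀ P.j₁).card : ℝ))
    -- the kit
    {Mz : ℕ} (hMz : Mz ∈ Sz) (hkz : D.k ≤ Mz) {ℓK : Fin 2 → ℕ} (hℓK0 : ∀ I, I = 0 → ℓK I ∈ Sx) (hℓK1 : ∀ I, I = 1 → ℓK I ∈ Sy)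
    {A : Fin 2 → Fin 2 → ℕ} {Rk : Fin 2 → ℕ} (hAw : ∀ I, A I = StepI.widths D.Gb D.Fb I (ℓK I)) (hRk : ∀ I, Rk I = D.R (amax (A I)))
    {ℓs M K R' r₀ rs : ℕ} (hℓs : 1 ≤ ℓs) (hwide : ∀ i, S.lo k i + 2 * tanOff ℓs M ≤ S.hi k i)
    (hA : ∀ i k, A i k ≤ M) (hAℓ : ∀ i, A i (oth i) ≤ ℓs) (hK : ∀ i, ℓs + 1 + A i i + Rk i ≤ K)
    (hnA : ∀ i, Mz + 1 ≤ A i i) (hnM : Mz ≤ M) (hρK : ∀ i, ℓs + 1 + A i i + (fatRadius hfr hC Mz + off) ≤ K)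
    (hR'₁ : cylRadMax G φ types ℓs (ℓs + 2 + 2 * tanOff ℓs M) ≤ R') (hR'₂ : ∀ i, cylRadMax G φ types ℓs (ℓs + 2 + A i i + Rk i) ≤ R')
    (hr₀₁ : ℓs + 1 + tanOff ℓs M + R' ≤ r₀) (hr₀₂ : ℓs + 2 + tanOff ℓs M + K ≤ r₀) (hR : r₀ ≤ R)
    (hrs₁ : ℓs + 2 + tanOff ℓs M + R' ≤ rs) (hrs₂ : ℓs + 2 + tanOff ℓs M + K ≤ rs) {cU : ℕ} (hcU : ∀ i, (Δ + 1) ^ Rk i ≤ cU)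
    -- the route rooms
    (hMℓ : Mz + 1 ≤ S.ℓ₀) (hS0 : S.ax k = 0 → ∀ ℓ, S.ℓ₀ ≤ ℓ → ℓ ≤ S.ℓ₁ → ℓ ∈ Sx) (hS1 : S.ax k = 1 → ∀ ℓ, S.ℓ₀ ≤ ℓ → ℓ ≤ S.ℓ₁ → ℓ ∈ Sy)
    (hdepth : ∀ I ℓ, S.ℓ₀ ≤ ℓ → ℓ ≤ S.ℓ₁ → 2 * ℓs + 2 + tanOff ℓs M + A I I + D.R (amax (StepI.widths D.Gb D.Fb (S.ax k) ℓ)) ≤ r₀)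
    (hWr : ∀ ℓ, S.ℓ₀ ≤ ℓ → ℓ ≤ S.ℓ₁ → StepI.widths D.Gb D.Fb (S.ax k) ℓ (oth (S.ax k)) ≤ S.Wb k ℓ)
    -- far inner neighbours of every level of the window lie in the enlarged target
    (hfarT : ∀ j ∈ Finset.Icc P.j₀ P.j₁, ∀ x ∈ outerBoundary (winGraph G w₀ R) (winLevel G φ w₀ R (S.lo k) (S.hi k) j),
      inNbr G φ w₀ R (Finset.Icc (S.lo k - (j : Site 2)) (S.hi k + (j : Site 2))) x ∉ graphBall G w₀ (R - r₀) →
      inNbr G φ w₀ R (Finset.Icc (S.lo k - (j : Site 2)) (S.hi k + (j : Site 2))) x ∈ P.coreE (planarWindowWin hlip w₀ R) S k)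
    -- the kit number
    (kk : ℕ) (hN : kk * (Δ + 1) ^ (2 * rs) ≤ P.N)
    (hkk : (1 - (q : ℝ) ^ (1 + Δ * ((Δ + 1) ^ R' + (tanOff ℓs M + 2)) + ((Δ + 1) ^ R' + (tanOff ℓs M + 2)) * cU)) ^ kk ≤ δ) :
    (P.stepA (planarWindowWin hlip w₀ R) S k).KitsAt Wt q Δ δ := by
  refine P.kitsAt_stepA (planarWindowWin hlip w₀ R) S hRl hRim hk hTne hsub hfin hDS ho hoS hj hcount fun j hjm => ?_
  have hjj : j ≤ P.j₁ := (Finset.mem_Icc.1 hjm).2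
  have hjR : j ≤ S.R' := (hjj.trans hj).trans (by omega)
  have hwidej : ∀ i, (S.lo k - (j : Site 2)) i + 2 * tanOff ℓs M ≤ (S.hi k + (j : Site 2)) i := fun i => by
    have := hwide i
    simp only [Pi.sub_apply, Pi.add_apply, Pi.natCast_apply]
    omega
  have hXD : winLevel G φ w₀ R (S.lo k) (S.hi k) j ⊆ (planarWindowWin hlip w₀ R).stepD S k :=
    winLevel_subset_stepD_win hlip S w₀ R hk hjR
  have hPD : Win G φ w₀ (S.region k) R ⊆ (planarWindowWin hlip w₀ R).stepD S k := subset_rfl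
  have hPT : Win G φ w₀ (S.core (k + 1)) R ⊆ P.coreE (planarWindowWin hlip w₀ R) S k := Finset.subset_union_left
  exact kitClause_stepI hlip hstep hfr hκ hΔ hC hD hδ h hMz hkz hℓK0 hℓK1 hAw hRk hℓs hwidej hA hAℓ hK hnA hnM hρK hR'₁ hR'₂ hr₀₁ hr₀₂
    hR hrs₁ hrs₂ hcU (S.ax k) hMℓ hS0 hS1 hdepth hWr (P.roomS S hRl hj hk j hjj) kk P.o P.Sfin hsub hXD hPD hPT
    (hfarT j hjm) hN hkk

/-- **`KitsAt` OF STEP `k` OF A WINDOW CHAIN IN `winGraph G w₀ R` FROM THE STEP-I′ CERTIFICATE, level-window form** (hp-8 g30 05:53:32Z):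
`kitsAt_stepA_win` with the unsatisfiable core-width hypothesis `hwide` REPLACED by `hj₀ : tanOff ℓs M ≤ P.j₀` — the slab room `2·T₀` is taken
from the level enlargement `j ≥ j₀ ≥ T₀` (cores of band schedules are segments, `lo k = hi k` along the axis), using `S.lo k ≤ S.hi k` (core
nonempty). Level-independent data: the kit (`Mz`, `ℓK`, `A`, `Rk`), the
slab/shell rooms with the core box `2·T₀` wide, the route rooms (`S.ℓ₀ > Mz`, certified extents `[S.ℓ₀, S.ℓ₁]` along `S.ax k`, depth, spread
`S.Wb k ≥` certified), the kit number `kk` and the count `P.N`. [cite: KozmaNitzan2024, §4 Lemma 10 (pp. 17–22), Lemma 11 (pp. 22–23)] -/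
theorem WinChainData.kitsAt_stepA_win' [Countable V] (hlip : Lip G φ) (hstep : Steps G φ) (hfr : Frames G φ types) (hκ : CylConn G φ types)
    {Δ : ℕ} (hΔ : ∀ v, G.degree v ≤ Δ) {p : unitInterval} (hC : CylSubcritical G φ types p) {D : StepI.Data V} {off : ℕ}
    (hD : D.Λ = fatSeqOff hfr hC off) {Sz Sx Sy : Finset ℕ} {q : unitInterval} {δ : ℝ} (hδ : 0 < δ)
    (h : ∀ i ∈ StepI.index types Sz Sx Sy, 1 - δ ^ 2 < (bondPercolation G q).real (StepI.event G φ D i))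
    (P : WinChainData V) (S : Schedule) {w₀ : V} {R : ℕ}
    -- the chain step
    (hRl : P.Rlev + 1 ≤ S.R') (hRim : ∀ k, P.Rim k ⊆ (planarWindowWin hlip w₀ R).stepD S k) {k : ℕ} (hk : k ≤ S.N)
    (hTne : ((planarWindowWin hlip w₀ R).coreT S k).Nonempty) {Wt : Sym2 V → unitInterval}
    (hsub : IsSubbox (winGraph G w₀ R) Wt q ((planarWindowWin hlip w₀ R).stepD S k)) (hfin : FinSupp Wt P.Sfin)
    (hDS : (planarWindowWin hlip w₀ R).stepD S k ⊆ P.Sfin) (ho : P.o ∉ (planarWindowWin hlip w₀ R).stepD S k) (hoS : P.o ∈ P.Sfin)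
    (hj : P.j₁ ≤ P.Rlev) (hcount : 1 / (1 - (q : ℝ)) ^ (Δ * P.N) ≤ δ * ((Finset.Icc P.j₀ P.j₁).card : ℝ))
    -- the kit
    {Mz : ℕ} (hMz : Mz ∈ Sz) (hkz : D.k ≤ Mz) {ℓK : Fin 2 → ℕ} (hℓK0 : ∀ I, I = 0 → ℓK I ∈ Sx) (hℓK1 : ∀ I, I = 1 → ℓK I ∈ Sy)
    {A : Fin 2 → Fin 2 → ℕ} {Rk : Fin 2 → ℕ} (hAw : ∀ I, A I = StepI.widths D.Gb D.Fb I (ℓK I)) (hRk : ∀ I, Rk I = D.R (amax (A I)))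
    {ℓs M K R' r₀ rs : ℕ} (hℓs : 1 ≤ ℓs) (hj₀ : tanOff ℓs M ≤ P.j₀)
    (hA : ∀ i k, A i k ≤ M) (hAℓ : ∀ i, A i (oth i) ≤ ℓs) (hK : ∀ i, ℓs + 1 + A i i + Rk i ≤ K)
    (hnA : ∀ i, Mz + 1 ≤ A i i) (hnM : Mz ≤ M) (hρK : ∀ i, ℓs + 1 + A i i + (fatRadius hfr hC Mz + off) ≤ K)
    (hR'₁ : cylRadMax G φ types ℓs (ℓs + 2 + 2 * tanOff ℓs M) ≤ R') (hR'₂ : ∀ i, cylRadMax G φ types ℓs (ℓs + 2 + A i i + Rk i) ≤ R')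
    (hr₀₁ : ℓs + 1 + tanOff ℓs M + R' ≤ r₀) (hr₀₂ : ℓs + 2 + tanOff ℓs M + K ≤ r₀) (hR : r₀ ≤ R)
    (hrs₁ : ℓs + 2 + tanOff ℓs M + R' ≤ rs) (hrs₂ : ℓs + 2 + tanOff ℓs M + K ≤ rs) {cU : ℕ} (hcU : ∀ i, (Δ + 1) ^ Rk i ≤ cU)
    -- the route rooms
    (hMℓ : Mz + 1 ≤ S.ℓ₀) (hS0 : S.ax k = 0 → ∀ ℓ, S.ℓ₀ ≤ ℓ → ℓ ≤ S.ℓ₁ → ℓ ∈ Sx) (hS1 : S.ax k = 1 → ∀ ℓ, S.ℓ₀ ≤ ℓ → ℓ ≤ S.ℓ₁ → ℓ ∈ Sy)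
    (hdepth : ∀ I ℓ, S.ℓ₀ ≤ ℓ → ℓ ≤ S.ℓ₁ → 2 * ℓs + 2 + tanOff ℓs M + A I I + D.R (amax (StepI.widths D.Gb D.Fb (S.ax k) ℓ)) ≤ r₀)
    (hWr : ∀ ℓ, S.ℓ₀ ≤ ℓ → ℓ ≤ S.ℓ₁ → StepI.widths D.Gb D.Fb (S.ax k) ℓ (oth (S.ax k)) ≤ S.Wb k ℓ)
    -- far inner neighbours of every level of the window lie in the enlarged target
    (hfarT : ∀ j ∈ Finset.Icc P.j₀ P.j₁, ∀ x ∈ outerBoundary (winGraph G w₀ R) (winLevel G φ w₀ R (S.lo k) (S.hi k) j),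
      inNbr G φ w₀ R (Finset.Icc (S.lo k - (j : Site 2)) (S.hi k + (j : Site 2))) x ∉ graphBall G w₀ (R - r₀) →
      inNbr G φ w₀ R (Finset.Icc (S.lo k - (j : Site 2)) (S.hi k + (j : Site 2))) x ∈ P.coreE (planarWindowWin hlip w₀ R) S k)
    -- the kit number
    (kk : ℕ) (hN : kk * (Δ + 1) ^ (2 * rs) ≤ P.N)
    (hkk : (1 - (q : ℝ) ^ (1 + Δ * ((Δ + 1) ^ R' + (tanOff ℓs M + 2)) + ((Δ + 1) ^ R' + (tanOff ℓs M + 2)) * cU)) ^ kk ≤ δ) :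
    (P.stepA (planarWindowWin hlip w₀ R) S k).KitsAt Wt q Δ δ := by
  refine P.kitsAt_stepA (planarWindowWin hlip w₀ R) S hRl hRim hk hTne hsub hfin hDS ho hoS hj hcount fun j hjm => ?_
  have hjj : j ≤ P.j₁ := (Finset.mem_Icc.1 hjm).2
  have hj0 : tanOff ℓs M ≤ j := hj₀.trans (Finset.mem_Icc.1 hjm).1
  have hjR : j ≤ S.R' := (hjj.trans hj).trans (by omega)
  have hlohi : S.lo k ≤ S.hi k := Finset.nonempty_Icc.1 (S.nonempty k (hk.trans (Nat.le_succ _)))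
  have hwidej : ∀ i, (S.lo k - (j : Site 2)) i + 2 * tanOff ℓs M ≤ (S.hi k + (j : Site 2)) i := fun i => by
    have := hlohi i
    have hj0' : (tanOff ℓs M : ℤ) ≤ j := by exact_mod_cast hj0
    simp only [Pi.sub_apply, Pi.add_apply, Pi.natCast_apply]
    linarith
  have hXD : winLevel G φ w₀ R (S.lo k) (S.hi k) j ⊆ (planarWindowWin hlip w₀ R).stepD S k :=
    winLevel_subset_stepD_win hlip S w₀ R hk hjR
  have hPD : Win G φ w₀ (S.region k) R ⊆ (planarWindowWin hlip w₀ R).stepD S k := subset_rfl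
  have hPT : Win G φ w₀ (S.core (k + 1)) R ⊆ P.coreE (planarWindowWin hlip w₀ R) S k := Finset.subset_union_left
  exact kitClause_stepI hlip hstep hfr hκ hΔ hC hD hδ h hMz hkz hℓK0 hℓK1 hAw hRk hℓs hwidej hA hAℓ hK hnA hnM hρK hR'₁ hR'₂ hr₀₁ hr₀₂
    hR hrs₁ hrs₂ hcU (S.ax k) hMℓ hS0 hS1 hdepth hWr (P.roomS S hRl hj hk j hjj) kk P.o P.Sfin hsub hXD hPD hPT
    (hfarT j hjm) hN hkk

end Skelφ

end Summit.CriticalPhenomena.PercolationContinuityZ3.Theorems.Transplant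

end
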